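import Summits.NavierStokesRegularity.FluidComputer.RowEncloseRef
import HarnessLib

/-!
# Enclosure soundness II: the frames, `Ȧ`, `G` and the residual `R` over the row
# (`pub-fluidc-bp3/R1-DESIGN.md` §9.2 / §9.4, layer B of `structure Row`)

HONEST FRAMING (cell `pub-fluidc`, blueprint seat bp3, gen 20): low prior, high value-of-information
experiment on Tao's machine paradigm; NOT a claim that NS blows up. Interval bookkeeping only.

The frames of a row are affine in the row parameter `v = (t − T₀)/H ∈ [0,1]`:
`A(v) = A₀ + vΔA`, `T̂(v) = T̂₀ + vΔT̂`. The real frames are any matrices enclosed by the row's interval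
tables (`Frames`, a `Type`-valued record: four real matrices and their memberships). This file proves
* `mem_dA`, `mem_dT`, `mem_AD` (`Ȧ = ΔA/H`), `mem_TA0`, `mem_TA1`, `mem_dTdA` for the stage `pre`;
* the residual identity `R(v) = I − T̂(v)A(v) = (1−v)(I − T̂₀A₀) + v(I − T̂₁A₁) + v(1−v)ΔT̂ΔA`
  (`Rv_entry`), whence `mem_RU : R(v) ∈ RU` (`v(1−v) ∈ [0,¼]`) and `Cert.hRm` (`Rm_le`);
* `mem_hull_seg` (an affine function on a parameter segment lies in the hull of its endpoint
  enclosures), whence `mem_Gabs : T̂(v)_{a,i+1} ∈ hull(T̂₀, T̂₁)` and `Cert.hGm` (`Gm_le`), and the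
  sub-interval frame enclosures `mem_Aseg`, `mem_Tseg` used by the coefficient step.

[cite: Tao2016AveragedNS, §5.5 Thm 5.3 (5.5)]
-/

namespace Summit.NavierStokesRegularity.FluidComputer

open Literature.Analysis.FluidPDE.FluidComputer
open Literature.Analysis.ValidatedNumerics.Numerics (cdiv)

namespace RowCheck

open DIVec ChainField Finset Real Set

/-- An affine function on a parameter segment lies in the hull of its endpoint enclosures.
[folklore] -/
theorem mem_hull_seg {P : ℕ} {I J : DI} {a d w₀ w₁ v : ℝ} (hx : I.mem P (a + w₀ * d))
    (hz : J.mem P (a + w₁ * d)) (h0 : w₀ ≤ v) (h1 : v ≤ w₁) : (I.hull J).mem P (a + v * d) :=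
  mem_hull_between hx hz (affine_between a d v w₀ w₁ h0 h1)

/-- `v(1−v) ∈ [0, ¼]` for `v ∈ [0,1]`, as the dyadic interval `⟨0, 2^(P−2)⟩`. [folklore] -/
theorem mem_quarter (P : ℕ) {v : ℝ} (hv : v ∈ Icc (0 : ℝ) 1) :
    (⟨0, (2 : ℤ) ^ (P - 2)⟩ : DI).mem P (v * (1 - v)) := by
  have hO : (0 : ℝ) < 2 ^ P := by positivity
  refine ⟨?_, ?_⟩
  · simp only [Int.cast_zero]
    exact mul_nonneg (mul_nonneg hv.1 (by linarith [hv.2])) hO.le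
  · push_cast
    have hq : v * (1 - v) ≤ 1 / 4 := by nlinarith [sq_nonneg (v - 1 / 2)]
    have hP : (2 : ℝ) ^ P ≤ 4 * 2 ^ (P - 2) := by
      rcases Nat.lt_or_ge P 2 with h | h
      · interval_cases P <;> norm_num
      · obtain ⟨k, rfl⟩ := Nat.exists_eq_add_of_le h
        rw [show 2 + k - 2 = k by omega, pow_add]; norm_num
    calc v * (1 - v) * 2 ^ P ≤ 1 / 4 * (4 * 2 ^ (P - 2)) :=
          mul_le_mul hq hP hO.le (by norm_num)
      _ = 2 ^ (P - 2) := by ring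

namespace RowData

variable (r : RowData)

/-- The real frames of a row: any real matrices enclosed by the interval tables (`Type`-valued
record of data and membership proofs). [folklore] -/
structure Frames : Type where
  /-- `A₀` -/
  A0 : Matrix (Fin 9) (Fin 9) ℝ
  /-- `A₁` -/
  A1 : Matrix (Fin 9) (Fin 9) ℝ
  /-- `T̂₀` -/
  T0 : Matrix (Fin 9) (Fin 9) ℝ
  /-- `T̂₁` -/
  T1 : Matrix (Fin 9) (Fin 9) ℝ
  /-- enclosed by `A0I` -/
  hA0 : ∀ i j, (r.A0I i j).mem r.P (A0 i j)
  /-- enclosed by `A1I` -/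
  hA1 : ∀ i j, (r.A1I i j).mem r.P (A1 i j)
  /-- enclosed by `T0I` -/
  hT0 : ∀ i j, (r.T0I i j).mem r.P (T0 i j)
  /-- enclosed by `T1I` -/
  hT1 : ∀ i j, (r.T1I i j).mem r.P (T1 i j)

namespace Frames

variable {r} (Fr : r.Frames)

/-- `ΔA = A₁ − A₀`. [folklore] -/
def dA : Matrix (Fin 9) (Fin 9) ℝ := Fr.A1 - Fr.A0
/-- `ΔT̂ = T̂₁ − T̂₀`. [folklore] -/
def dT : Matrix (Fin 9) (Fin 9) ℝ := Fr.T1 - Fr.T0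
/-- `A(v) = A₀ + vΔA`. [folklore] -/
def Av (v : ℝ) : Matrix (Fin 9) (Fin 9) ℝ := Fr.A0 + v • Fr.dA
/-- `T̂(v) = T̂₀ + vΔT̂`. [folklore] -/
def Tv (v : ℝ) : Matrix (Fin 9) (Fin 9) ℝ := Fr.T0 + v • Fr.dT
/-- `R(v) = I − T̂(v)A(v)`. [folklore] -/
def Rv (v : ℝ) : Matrix (Fin 9) (Fin 9) ℝ := 1 - Fr.Tv v * Fr.Av v

/-! ### The stage `pre` -/

/-- [folklore] -/
theorem pre_dA : r.pre.dA = Tab.mk' (subM r.A1I r.A0I) := rfl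
/-- [folklore] -/
theorem pre_dT : r.pre.dT = Tab.mk' (subM r.T1I r.T0I) := rfl
/-- [folklore] -/
theorem pre_AD : r.pre.AD = Tab.mk' fun i j =>
    ((Tab.mk' (subM r.A1I r.A0I)).at i j).mul r.P ((ofFrac r.P r.Hq).inv r.P) := rfl
/-- [folklore] -/
theorem pre_TA0 : r.pre.TA0 = Tab.mk' (mul r.P r.T0I r.A0I) := rfl
/-- [folklore] -/
theorem pre_TA1 : r.pre.TA1 = Tab.mk' (mul r.P r.T1I r.A1I) := rfl
/-- [folklore] -/
theorem pre_dTdA : r.pre.dTdA =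
    Tab.mk' (mul r.P (Tab.mk' (subM r.T1I r.T0I)).at (Tab.mk' (subM r.A1I r.A0I)).at) := rfl

/-- `ΔA ∈ pre.dA`. [folklore] -/
theorem mem_dA (i j : Fin 9) : (r.pre.dA.at i j).mem r.P (Fr.dA i j) := by
  rw [pre_dA, Tab.at_mk']
  exact mem_subM r.P Fr.hA1 Fr.hA0 i j

/-- `ΔT̂ ∈ pre.dT`. [folklore] -/
theorem mem_dT (i j : Fin 9) : (r.pre.dT.at i j).mem r.P (Fr.dT i j) := by
  rw [pre_dT, Tab.at_mk']
  exact mem_subM r.P Fr.hT1 Fr.hT0 i j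

/-- `Ȧ = ΔA/H ∈ pre.AD` (when the interval of `H` is positive). [folklore] -/
theorem mem_AD (hH : 0 < (ofFrac r.P r.Hq).lo) (i j : Fin 9) :
    (r.pre.AD.at i j).mem r.P (Fr.dA i j / r.Hq) := by
  rw [pre_AD, Tab.at_mk', div_eq_mul_one_div]
  refine DI.mem_mul ?_ (DI.mem_inv hH (mem_ofFrac r.P r.Hq))
  have := Fr.mem_dA i j
  rwa [pre_dA] at this

/-- `T̂₀A₀ ∈ pre.TA0`. [folklore] -/
theorem mem_TA0 (i j : Fin 9) : (r.pre.TA0.at i j).mem r.P ((Fr.T0 * Fr.A0) i j) := by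
  rw [pre_TA0, Tab.at_mk']
  exact mem_mul r.P Fr.hT0 Fr.hA0 i j

/-- `T̂₁A₁ ∈ pre.TA1`. [folklore] -/
theorem mem_TA1 (i j : Fin 9) : (r.pre.TA1.at i j).mem r.P ((Fr.T1 * Fr.A1) i j) := by
  rw [pre_TA1, Tab.at_mk']
  exact mem_mul r.P Fr.hT1 Fr.hA1 i j

/-- `ΔT̂ΔA ∈ pre.dTdA`. [folklore] -/
theorem mem_dTdA (i j : Fin 9) : (r.pre.dTdA.at i j).mem r.P ((Fr.dT * Fr.dA) i j) := by
  rw [pre_dTdA, Tab.at_mk']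
  refine mem_mul r.P (fun a b => ?_) (fun a b => ?_) i j
  · have := Fr.mem_dT a b
    rwa [pre_dT] at this
  · have := Fr.mem_dA a b
    rwa [pre_dA] at this

/-! ### The residual identity and `RU` -/

/-- Entrywise residual identity
`R(v) = (1−v)(I − T̂₀A₀) + v(I − T̂₁A₁) + v(1−v)ΔT̂ΔA`. [folklore] -/
theorem Rv_entry (v : ℝ) (i j : Fin 9) : Fr.Rv v i j =
    ((1 - v) * (1 - Fr.T0 * Fr.A0) i j + v * (1 - Fr.T1 * Fr.A1) i j) +
      v * (1 - v) * (Fr.dT * Fr.dA) i j := by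
  simp only [Rv, Tv, Av, dT, dA, Matrix.sub_apply, Matrix.one_apply, Matrix.mul_apply,
    Matrix.add_apply, Matrix.smul_apply, smul_eq_mul]
  have hs : ∑ k, (Fr.T0 i k + v * (Fr.T1 i k - Fr.T0 i k)) * (Fr.A0 k j + v * (Fr.A1 k j - Fr.A0 k j))
      = (1 - v) * ∑ k, Fr.T0 i k * Fr.A0 k j + v * ∑ k, Fr.T1 i k * Fr.A1 k j -
          v * (1 - v) * ∑ k, (Fr.T1 i k - Fr.T0 i k) * (Fr.A1 k j - Fr.A0 k j) := by
    rw [Finset.mul_sum, Finset.mul_sum, Finset.mul_sum, ← Finset.sum_add_distrib,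
      ← Finset.sum_sub_distrib]
    exact Finset.sum_congr rfl fun k _ => by ring
  rw [hs]
  split_ifs <;> ring

/-- `R(v) ∈ RU` over the whole row (`v ∈ [0,1]`). [folklore] -/
theorem mem_RU {v : ℝ} (hv : v ∈ Icc (0 : ℝ) 1) (i j : Fin 9) :
    ((r.RU r.pre).at i j).mem r.P (Fr.Rv v i j) := by
  rw [RU, Tab.at_mk', Rv_entry]
  refine DI.mem_add ?_ (DI.mem_mul (mem_quarter r.P hv) (Fr.mem_dTdA i j))
  have hx : ((eyeI r.P i j).sub (r.pre.TA0.at i j)).mem r.P ((1 - Fr.T0 * Fr.A0) i j) := by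
    have := DI.mem_sub (mem_eyeI r.P i j) (Fr.mem_TA0 i j)
    simpa [Matrix.sub_apply, Matrix.one_apply] using this
  have hz : ((eyeI r.P i j).sub (r.pre.TA1.at i j)).mem r.P ((1 - Fr.T1 * Fr.A1) i j) := by
    have := DI.mem_sub (mem_eyeI r.P i j) (Fr.mem_TA1 i j)
    simpa [Matrix.sub_apply, Matrix.one_apply] using this
  have h := mem_hull_seg (a := (1 - Fr.T0 * Fr.A0) i j)
    (d := (1 - Fr.T1 * Fr.A1) i j - (1 - Fr.T0 * Fr.A0) i j) (w₀ := 0) (w₁ := 1) (v := v)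
    (by simpa using hx) (by simpa using hz) hv.1 hv.2
  convert h using 1
  ring

/-- `Cert.hRm`: `|R(v)_{ab}| ≤ Rm_{ab}` on the row. [folklore] -/
theorem Rm_le {v : ℝ} (hv : v ∈ Icc (0 : ℝ) 1) (a b : Fin 9) :
    |Fr.Rv v a b| ≤ (((r.RU r.pre).at a b).mag : ℝ) / 2 ^ r.P :=
  DI.abs_le_mag (Fr.mem_RU hv a b)

/-! ### `G` and the sub-interval frames -/

/-- `T̂(v)_{a,i+1} ∈ hull(T̂₀, T̂₁)_{a,i+1}` (`v ∈ [0,1]`). [folklore] -/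
theorem mem_Gabs {v : ℝ} (hv : v ∈ Icc (0 : ℝ) 1) (a : Fin 9) (i : Fin 8) :
    ((r.T0I a i.succ).hull (r.T1I a i.succ)).mem r.P (Fr.Tv v a i.succ) := by
  have h := mem_hull_seg (a := Fr.T0 a i.succ) (d := Fr.T1 a i.succ - Fr.T0 a i.succ) (w₀ := 0)
    (w₁ := 1) (v := v) (by simpa using Fr.hT0 a i.succ) (by simpa using Fr.hT1 a i.succ) hv.1 hv.2
  convert h using 1
  simp [Tv, dT, Matrix.add_apply, Matrix.smul_apply, Matrix.sub_apply]

/-- `Cert.hGm`: `|G(v)_{ai}| ≤ Gm_{ai}` on the row. [folklore] -/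
theorem Gm_le {v : ℝ} (hv : v ∈ Icc (0 : ℝ) 1) (a : Fin 9) (i : Fin 8) :
    |Fr.Tv v a i.succ| ≤ ((r.Gabs a i : ℤ) : ℝ) / 2 ^ r.P :=
  DI.abs_le_mag (Fr.mem_Gabs hv a i)

/-- Sub-interval frame enclosure: `A(v)_{ij} ∈ hull(A₀ + v_a ΔA, A₀ + v_b ΔA)_{ij}` for
`v ∈ [w₀, w₁]`, `w₀ ∈ v_a`, `w₁ ∈ v_b`. [folklore] -/
theorem mem_Aseg {va vb : DI} {w₀ w₁ v : ℝ} (ha : va.mem r.P w₀) (hb : vb.mem r.P w₁)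
    (h0 : w₀ ≤ v) (h1 : v ≤ w₁) (i j : Fin 9) :
    (((r.A0I i j).add (va.mul r.P (r.pre.dA.at i j))).hull
      ((r.A0I i j).add (vb.mul r.P (r.pre.dA.at i j)))).mem r.P (Fr.Av v i j) := by
  have h := mem_hull_seg (DI.mem_add (Fr.hA0 i j) (DI.mem_mul ha (Fr.mem_dA i j)))
    (DI.mem_add (Fr.hA0 i j) (DI.mem_mul hb (Fr.mem_dA i j))) h0 h1
  convert h using 1
  simp [Av, Matrix.add_apply, Matrix.smul_apply]

/-- Sub-interval enclosure of the slot columns of `T̂(v)`. [folklore] -/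
theorem mem_Tseg {va vb : DI} {w₀ w₁ v : ℝ} (ha : va.mem r.P w₀) (hb : vb.mem r.P w₁)
    (h0 : w₀ ≤ v) (h1 : v ≤ w₁) (i : Fin 9) (j : Fin 8) :
    (((r.T0I i j.succ).add (va.mul r.P (r.pre.dT.at i j.succ))).hull
      ((r.T0I i j.succ).add (vb.mul r.P (r.pre.dT.at i j.succ)))).mem r.P (Fr.Tv v i j.succ) := by
  have h := mem_hull_seg (DI.mem_add (Fr.hT0 i j.succ) (DI.mem_mul ha (Fr.mem_dT i j.succ)))
    (DI.mem_add (Fr.hT0 i j.succ) (DI.mem_mul hb (Fr.mem_dT i j.succ))) h0 h1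
  convert h using 1
  simp [Tv, Matrix.add_apply, Matrix.smul_apply]

/-- Sub-interval enclosure of `R(v)`:
`(1−v)(I − T̂₀A₀) + v(I − T̂₁A₁) + v(1−v)ΔT̂ΔA` with `1−v ∈ OmV`, `v ∈ Va`, `v(1−v) ∈ VV`. [folklore] -/
theorem mem_Rseg {Va OmV VV : DI} {v : ℝ} (hV : Va.mem r.P v) (hO : OmV.mem r.P (1 - v))
    (hVV : VV.mem r.P (v * (1 - v))) (i j : Fin 9) :
    (((OmV.mul r.P ((eyeI r.P i j).sub (r.pre.TA0.at i j))).add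
      (Va.mul r.P ((eyeI r.P i j).sub (r.pre.TA1.at i j)))).add
        (VV.mul r.P (r.pre.dTdA.at i j))).mem r.P (Fr.Rv v i j) := by
  rw [Rv_entry]
  refine DI.mem_add (DI.mem_add (DI.mem_mul hO ?_) (DI.mem_mul hV ?_))
    (DI.mem_mul hVV (Fr.mem_dTdA i j))
  · have := DI.mem_sub (mem_eyeI r.P i j) (Fr.mem_TA0 i j)
    simpa [Matrix.sub_apply, Matrix.one_apply] using this
  · have := DI.mem_sub (mem_eyeI r.P i j) (Fr.mem_TA1 i j)
    simpa [Matrix.sub_apply, Matrix.one_apply] using this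

end Frames

end RowData

end RowCheck

end Summit.NavierStokesRegularity.FluidComputer
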